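import Literature.MathematicalPhysics.QuantumFieldTheory.Balaban1983to89.Node00.HistoryTermDatum214
import Literature.MathematicalPhysics.QuantumFieldTheory.Balaban1983to89.B13Term214WindowDilated

/-!
# NODE 00 (YM-PLAN Track A) — W1 = [II] §2 (2.13)–(2.14), STOREY 11: THE UNSCALED-FIELD LAW OF A (2.14) TERM DATUM AND ITS WINDOW-DILATED
# MEMBER FAMILY (`W1.TermDatum214.UnscaledFieldLawOn`, `W1.TermDatum214.memberTF`, `W1.TermDatum214.continuedTF`, `W1.TermDatum214.ofUnscaled`;
# family level `W1.TermData214.UnscaledFieldLawOn ∕ memberTF ∕ continuedTF`)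

NODE 00 DEFINER MODULE (seat `pub-ymgap-node00-def-W1`, generation 13, 2026-08-27).  APPEND-ONLY: a NEW importing module; g7's
`Node00/HistoryTermDatum214` (`TermDatum214`, `.A`, `.Gam`, `.TF`, `TF_apply`, `sigmaList`, `tauList`, `TermData214`) and dag-n10-c g6's
`B13Term214WindowDilated` (§1 `term214_dilate_family`, §6 `term214_windowDilated_basePoint`) untouched and CONSUMED BY NAME.  Typed on the
pub-ymgap bus ask DESIGN-INPUT-W1 of seat `pub-ymgap-dag-n22-c` g7 (2026-08-27 11:00Z) with its AMENDMENT (11:27Z: the Wilson remainder is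
HISTORY-FREE); the member's display is, BYTE FOR BYTE, the lambda of that seat's theorems-only module
`Summits/QuantumFields/YangMills/Theorems/BalabanUVNodesN22W1RelCentredMembersOfDatum` (`memberOfDatum_basePoint`, `memberOfDatum_one_eq_TF`), which this
definition wraps by `rfl`.
[II] = [Balaban1988RG2Cluster] T. Bałaban, *Renormalization group approach to lattice gauge field theories. II. Cluster expansions*, Commun. Math.
Phys. **116** (1988) 1–22; [I] = [Balaban1987RG1], part I, Commun. Math. Phys. **109** (1987) 249–301.

CITATION HEADER (PDF held: `paper:balaban1987-cmp109-rg-i-small-field`, journal page = PDF page + 248; `paper:balaban1988-cmp116-rg-ii-cluster`,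
journal page = PDF page).  [I] p. 266 (2.9): *"Finally we can define the characteristic function χ_k = Π χ({|B′(b)| < ε₁})"* — the small-field boxes
are conditions on the UNSCALED fluctuation field `B′`; p. 267 after (2.10): *"Next we make the scaling transformation B = g_kB′. In the expression
under the exponential the third, linear term in (2.10) vanishes now … Hence the only term with a negative power of g_k is the action evaluated at the
configuration U_{k+1}"*; p. 268 (2.12)–(2.13): the new term `E^{(k+1)}(g_k, U_{k+1}) = log ∫ dμ_{C^{(k)}}(B) χ_k exp[P^{(k)}(g_k, U_{k+1}, B) + {…}]` with
the older terms `E_k` entering through `{…}` by EVALUATION at the rescaled fluctuation, and *"the expression under the exponential above vanishes at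
g_k = 0"*.  [II] p. 15 (2.14): the generic term, its last line `(−1)^{|P|} χ_{k,Y₀}(B) χᶜ_{k,P}(B) exp[Σ_{Y∈𝐃} τ(Y)𝐕_k(Y, B)]`.

THE PIN.  W1-7's term datum `𝔇 : TermDatum214 c P 𝔸 M k L` carries the last-line data of (2.14) as OPAQUE functions of the coupling:
`chiY₀ Z t s`, `chicP Z t s` (the characteristic functions AT the coupling `s`) and `𝒱 Z t s old φ` (the potentials at coupling, older terms,
configuration).  Print's (2.9)–(2.13) say HOW the real coupling enters them: after the scaling transformation `B = g_kB′` of [I] p. 267 the boxes,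
the Wilson remainder and the older terms are COUPLING-FREE functions of the UNSCALED field READ AT `g_k·B`, the Wilson remainder carrying the explicit
prefactor `g_k⁻²` and NOT reading the history (the couplings `g₀ … g_{k−1}` enter only through the older terms, [I] (2.12)–(2.13)).  THIS STOREY TYPES:
* §1 the data types of the unscaled-field reading (`UnscaledChi`, `UnscaledWilson`, `UnscaledOlder`) and **THE UNSCALED-FIELD LAW**
  `𝔇.UnscaledFieldLawOn γ χᵘ χᶜᵘ 𝒲 𝒪` (hypothesis schema — a LAW on the datum, NOT asserted; stated ONLY on the REAL window `s ∈ ]0, γ]`):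
  `χ_{k,Y₀}(s, B) = χᵘ(s·B)`, `χᶜ_{k,P}(s, B) = χᶜᵘ(s·B)`, `𝐕_k(Y; s, old, φ; B) = s⁻²·𝒲(φ; Y, s·B) + 𝒪(old, φ; Y, s·B)`;
* §2 **THE WINDOW-DILATED MEMBER OF BASE POINT `s₀`**: `𝔇.memberTF χᵘ χᶜᵘ 𝒲 𝒪 s₀ : W1.TermFun P 𝔸 M k L`, the dilation parameter `b ∈ ℂ` in the
  coupling slot — dag-n10-c's window-dilated family `(b²·A, b·Γ, F214 |P| χᵘ(s₀·) χᶜᵘ(s₀·) 𝐃 (b²·W_{s₀} + O_{s₀}))` AT THE DATUM's kernels, with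
  `W_{s₀}(Y, B) := s₀⁻²𝒲(φ; Y, s₀B)`, `O_{s₀}(Y, B) := 𝒪(old, φ; Y, s₀B)` ([I] p. 267 «B = g_kB′» at the FIXED REAL `g_k = s₀`, then a complex number
  `b` — for the consumer `b = s₀∕u`, `u` a complex last coupling near `s₀` — multiplying the interior precision (`b²`), the cross kernel (`b`) and the
  Wilson part (`b²`); boxes and older terms `b`-free); `@[reducible]`, display `memberTF_apply` (`rfl`);
* §3 ITS ALGEBRA: `memberTF_congr_old` (the history enters through `𝒪` only); ★ `memberTF_basePoint` (LAW-FREE base-point freeness through the REAL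
  ratio: `m(s₁, (s₁∕s₀)·b) = m(s₀, b)` — `term214_windowDilated_basePoint` by name; the window form is the Summit-side `hMbase` binder shape);
  ★ `memberTF_one_eq_TF` (under the law, the member `b = 1` of base point `s` IS the datum's display at coupling `s` — the `hMagree` binder shape; also
  the pointwise form `memberTF_one_eq_TF_of_lawAt`); `memberTF_ofReal_div_eq_TF` (under the law, the REAL member `b = s₀∕s` of base point `s₀` is the
  display at coupling `s` — [I]'s scaling read at two couplings, `B13Term214WindowDilated` §7's `hagree` in datum currency);
* §4 **THE CONTINUED TERM FUNCTIONAL READ FROM THE BASE POINT `γ`**: `𝔇.continuedTF χᵘ χᶜᵘ 𝒲 𝒪 γ : W1.TermFun P 𝔸 M k L`,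
  `(Z, t, u, old, φ) ↦ m(γ, γ∕u)` — ONE function of the complex last coupling `u`; `continuedTF_eq_memberTF` (law-free: at ANY base point `t₀ ≠ 0` it
  reads `m(t₀, t₀∕u)`), `continuedTF_ofReal_eq_TF` (under the law it AGREES with the datum's display at every real window coupling — the Summit-side
  `hagree` clause of the relative-disc road for `TFc := 𝔇.continuedTF … γ`, now a theorem of the law instead of a display);
* §5 FAMILY LEVEL (`𝔇 : TermData214 c P 𝔸 M L`, one datum per step): `TermData214.UnscaledFieldLawOn` (`_iff`: `Iff.rfl` with the per-step
  conjunction), `TermData214.memberTF : ℝ → GenTermFun P 𝔸 M L` (THE `mF` of the Summit-side window-dilated s1 leaf, `memberTF_apply` `rfl`),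
  `TermData214.memberTF_basePoint` ∕ `memberTF_one_eq_TF` (its `hMbase` ∕ `hMagree` binders VERBATIM), `TermData214.continuedTF` (+ faces);
* §6 HONESTY — THE LAW IS A READING, AND IT IS INHABITED: `𝔇.ofUnscaled χᵘ χᶜᵘ 𝒲 𝒪` = the datum with the same kernels, configuration reading and
  Cauchy radius whose last-line fields ARE the unscaled-field reading (`χ_{k,Y₀}(s, B) := χᵘ((Re s)·B)`, …, `𝐕_k := s⁻²𝒲((Re s)·B) + 𝒪((Re s)·B)`; off the
  real axis this is the junk extension by `Re s` — the law reads the real window only); `unscaledFieldLawOn_ofUnscaled` (it obeys the law on every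
  window), `memberTF_ofUnscaled` (`rfl`: the member family does not read the datum's last-line fields at all), `exists_unscaledFieldLawOn`.
All proofs are `rfl` ∕ `one_smul` ∕ `smul_smul` ∕ `field_simp` ∕ ONE application of `B13Term214WindowDilated.term214_windowDilated_basePoint` (in `memberTF_basePoint_of_ne_zero`; every other base-point statement is its corollary).

LINEAGE NOTES.  (i) Lens T16(k2) (cell memo, recorded for the next W1 module by this seat's g10): the DISPLAYED history-indexed terms are the
small-field (2.14) terms (boxes `χ_{k,Y₀}`); the `χᶜ_{k,P}`-keyed large-field part meets the own-coupling socket through the large-field estimate [II] (2.22)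
(«γ₂ a small, positive constant», p. 16; typed Summit-side as `χᵘχᶜᵘ ≤ exp(−½γ₂r_P²|P| + ½γ₂q_P(B))` at `r_P = ε₁∕s₀`) — here, as in W1-7, BOTH box functions are primitive
data, now read in the unscaled field (`χᵘ`, `χᶜᵘ`).  (ii) This seat's g11 declined a
two-coupling reading `TF₂` as «the continued family as an object» because it agreed with the display only on the diagonal; the window-dilated member family (dag-n10-c
`B13Term214WindowDilated`, the Summit-side s1 leaf's `mF`∕`TFc`) resolves exactly that: `continuedTF` agrees with the display at EVERY real window coupling under the law
(`continuedTF_ofReal_eq_TF`), its holomorphy on the relative sector staying the consumers' theorem.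

WHAT IS LEFT TO THE CONSUMERS (not typed here, by design — one declarer each): the member statements hMlast ∕ hMprop ∕ hMcen (holomorphy and (2.26)
in `b` on the ball `|b − 1| < ρ_b`, holomorphy along older-term curves, the centred letter) = dag-n10-c's `B13Term214WindowDilated` §4∕§5 and
`B13Bound226Centred[Rem]` AT THE DATUM from located primitive inputs (Summit-side `…N22W1RelCentredMembersOfDatum{Bound,Tails,Centred}`); the
inhabitant OF RECORD of the law (NODE 00's datum read from def-B13's kernels with [I]'s scaling — Lemma 2's construction (1.33)–(1.41), N09∕N10).

HONEST FRAMING: definitions + algebra; the unscaled-field law is a HYPOTHESIS SCHEMA (displayed, never asserted; `ofUnscaled` shows it is a reading,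
not a constraint that could be vacuous); NO estimate; nothing of Bałaban's asserted or constructed; N22 ∕ N10 ∕ N09 NOT discharged; K3 untouched; counts
unmoved; one finite 𝕋⁴ programme at fixed ε, Bałaban as printed — NOT continuum ∕ ℝ⁴ ∕ infinite volume ∕ OS ∕ mass gap ∕ Clay.  No `sorry`, no `axiom`,
no `instance` declaration, no `notation`.

References (TYPES and page anchors only): [I] §1 p. 263 (the window `g ∈ [0, γ]`), (2.9) p. 266, (2.10)–(2.11) p. 267, (2.12)–(2.13) p. 268;
[II] (1.41) p. 11, (2.3) p. 12, (2.14) p. 15.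
-/

open scoped BigOperators

noncomputable section

namespace Literature.MathematicalPhysics.QuantumFieldTheory.Balaban1983to89.Node00

open Metric Set
open Literature.MathematicalPhysics.QuantumFieldTheory.Balaban1983to89
open TreeLengthTorus Sect2
open Literature.MathematicalPhysics.QuantumFieldTheory.Balaban1983to89.B13Term214 (term214 core214 F214)
open Literature.MathematicalPhysics.QuantumFieldTheory.Balaban1983to89.B13Term214WindowDilated (term214_windowDilated_basePoint)

namespace W1

namespace TermDatum214

variable {c : B13.Consts} {P : Params} {𝔸 : Type*} {M k L : ℕ} [NeZero L] (𝔇 : TermDatum214 c P 𝔸 M k L)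

/-! ## §1  The unscaled-field reading of the last-line data and the unscaled-field law on the real window -/

/-- **Data type: a characteristic function of the UNSCALED row-bond fluctuation field** (`χᵘ(B′)`, [I] (2.9): `Π χ({|B′(b)| < ε₁})`; coupling-free),
per `Z ∈ 𝐃_{k+1}` and term label. [cite: Balaban1987RG1, (2.9) p.266; Balaban1988RG2Cluster, (2.3) p.12] -/
abbrev UnscaledChi : Type _ :=
  (Z : (domSys P M (k + 1)).Dom) → (t : TermLabel P M k L) → ((𝔇.𝒦 Z t).Λ → ℝ) → ℝ

/-- **Data type: the Wilson remainder `𝒲(φ; Y, B′)` read in the UNSCALED field** — the third-and-higher-order part of the expanded action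
(`V(H₁B′)` of [I] (2.8), carrying the prefactor `g_k⁻²` in (2.10)); HISTORY-FREE: it reads the configuration, the domain `Y` and the field only
([I] (2.12)–(2.13): the couplings `g₀, …, g_{k−1}` enter the step ONLY through the older terms). [cite: Balaban1987RG1, (2.8) p.266, (2.10) p.267 and (2.12)-(2.13) p.268] -/
abbrev UnscaledWilson : Type _ :=
  (Z : (domSys P M (k + 1)).Dom) → (t : TermLabel P M k L) → CPair P 𝔸 → TDom P.d (L * domCount P M (k + 1)) → ((𝔇.𝒦 Z t).Λ → ℝ) → ℂ

/-- **Data type: the older-terms part `𝒪(old, φ; Y, B′)` of the potentials read in the UNSCALED field** — the terms `E_k` of all the previous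
actions evaluated at the configuration moved by the unscaled fluctuation ([I] (2.10), (2.12): `E_k(U_k(exp iB′ …))`; [II] (1.41)).
[cite: Balaban1987RG1, (2.10) p.267 and (2.12)-(2.13) p.268; Balaban1988RG2Cluster, (1.41) p.11] -/
abbrev UnscaledOlder : Type _ :=
  (Z : (domSys P M (k + 1)).Dom) → (t : TermLabel P M k L) → OlderTerms P 𝔸 M k → CPair P 𝔸 →
    TDom P.d (L * domCount P M (k + 1)) → ((𝔇.𝒦 Z t).Λ → ℝ) → ℂ

variable (χu χcu : 𝔇.UnscaledChi) (𝒲 : 𝔇.UnscaledWilson) (𝒪 : 𝔇.UnscaledOlder)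

/-- **THE UNSCALED-FIELD LAW ON THE REAL WINDOW `]0, γ]`** (hypothesis schema — a LAW on the datum's opaque last-line fields, NOT typed as holding):
after the scaling transformation `B = g_kB′` of [I] p. 267 at a REAL coupling `s`, the small-field boxes, the large-field function, the Wilson
remainder (× `s⁻²`) and the older terms are the coupling-free unscaled-field data READ AT `s·B`:
`χ_{k,Y₀}(s, B) = χᵘ(s·B)`, `χᶜ_{k,P}(s, B) = χᶜᵘ(s·B)`, `𝐕_k(Y; s, old, φ; B) = s⁻²·𝒲(φ; Y, s·B) + 𝒪(old, φ; Y, s·B)` for every `s ∈ ]0, γ]`.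
Stated ONLY at real couplings of the window (print's thresholds are real; no complex coupling is read through the boxes).
[cite: Balaban1987RG1, (2.9) p.266, (2.10)-(2.11) p.267, (2.12)-(2.13) p.268 and §1 p.263; Balaban1988RG2Cluster, (2.14) p.15 and (1.41) p.11] -/
def UnscaledFieldLawOn (γ : ℝ) : Prop :=
  ∀ (Z : (domSys P M (k + 1)).Dom) (t : TermLabel P M k L), ∀ s ∈ Ioc (0 : ℝ) γ,
    (∀ B, 𝔇.chiY₀ Z t (s : ℂ) B = χu Z t (s • B)) ∧ (∀ B, 𝔇.chicP Z t (s : ℂ) B = χcu Z t (s • B)) ∧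
      ∀ (old : OlderTerms P 𝔸 M k) (φ : CPair P 𝔸) (Y : TDom P.d (L * domCount P M (k + 1))) (B : (𝔇.𝒦 Z t).Λ → ℝ),
        𝔇.𝒱 Z t (s : ℂ) old φ Y B = (((s : ℝ) : ℂ) ^ 2)⁻¹ * 𝒲 Z t φ Y (s • B) + 𝒪 Z t old φ Y (s • B)

/-- The law unfolded (`Iff.rfl`). [cite: Balaban1987RG1, (2.9)-(2.13) pp.266-268 (bookkeeping)] -/
theorem unscaledFieldLawOn_iff (γ : ℝ) :
    𝔇.UnscaledFieldLawOn χu χcu 𝒲 𝒪 γ ↔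
      ∀ (Z : (domSys P M (k + 1)).Dom) (t : TermLabel P M k L), ∀ s ∈ Ioc (0 : ℝ) γ,
        (∀ B, 𝔇.chiY₀ Z t (s : ℂ) B = χu Z t (s • B)) ∧ (∀ B, 𝔇.chicP Z t (s : ℂ) B = χcu Z t (s • B)) ∧
          ∀ (old : OlderTerms P 𝔸 M k) (φ : CPair P 𝔸) (Y : TDom P.d (L * domCount P M (k + 1))) (B : (𝔇.𝒦 Z t).Λ → ℝ),
            𝔇.𝒱 Z t (s : ℂ) old φ Y B = (((s : ℝ) : ℂ) ^ 2)⁻¹ * 𝒲 Z t φ Y (s • B) + 𝒪 Z t old φ Y (s • B) :=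
  Iff.rfl

variable {χu χcu 𝒲 𝒪}

/-- The law on a window holds on every smaller window. [cite: Balaban1987RG1, §1 p.263 (bookkeeping)] -/
theorem UnscaledFieldLawOn.mono {γ γ' : ℝ} (h : 𝔇.UnscaledFieldLawOn χu χcu 𝒲 𝒪 γ) (hγ : γ' ≤ γ) :
    𝔇.UnscaledFieldLawOn χu χcu 𝒲 𝒪 γ' :=
  fun Z t s hs => h Z t s ⟨hs.1, hs.2.trans hγ⟩

/-- Projection: the small-field boxes at a window coupling read the unscaled field. [cite: Balaban1987RG1, (2.9) p.266 and p.267] -/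
theorem UnscaledFieldLawOn.chiY₀_eq {γ : ℝ} (h : 𝔇.UnscaledFieldLawOn χu χcu 𝒲 𝒪 γ) (Z : (domSys P M (k + 1)).Dom) (t : TermLabel P M k L)
    {s : ℝ} (hs : s ∈ Ioc (0 : ℝ) γ) (B : (𝔇.𝒦 Z t).Λ → ℝ) : 𝔇.chiY₀ Z t (s : ℂ) B = χu Z t (s • B) :=
  (h Z t s hs).1 B

/-- Projection: the large-field function at a window coupling reads the unscaled field. [cite: Balaban1987RG1, (2.9) p.266 and p.267] -/
theorem UnscaledFieldLawOn.chicP_eq {γ : ℝ} (h : 𝔇.UnscaledFieldLawOn χu χcu 𝒲 𝒪 γ) (Z : (domSys P M (k + 1)).Dom) (t : TermLabel P M k L)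
    {s : ℝ} (hs : s ∈ Ioc (0 : ℝ) γ) (B : (𝔇.𝒦 Z t).Λ → ℝ) : 𝔇.chicP Z t (s : ℂ) B = χcu Z t (s • B) :=
  (h Z t s hs).2.1 B

/-- Projection: the potentials at a window coupling are `s⁻²·𝒲 + 𝒪` read in the unscaled field. [cite: Balaban1987RG1, (2.10) p.267 and (2.12)-(2.13) p.268] -/
theorem UnscaledFieldLawOn.𝒱_eq {γ : ℝ} (h : 𝔇.UnscaledFieldLawOn χu χcu 𝒲 𝒪 γ) (Z : (domSys P M (k + 1)).Dom) (t : TermLabel P M k L)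
    {s : ℝ} (hs : s ∈ Ioc (0 : ℝ) γ) (old : OlderTerms P 𝔸 M k) (φ : CPair P 𝔸) (Y : TDom P.d (L * domCount P M (k + 1)))
    (B : (𝔇.𝒦 Z t).Λ → ℝ) :
    𝔇.𝒱 Z t (s : ℂ) old φ Y B = (((s : ℝ) : ℂ) ^ 2)⁻¹ * 𝒲 Z t φ Y (s • B) + 𝒪 Z t old φ Y (s • B) :=
  (h Z t s hs).2.2 old φ Y B

/-! ## §2  The window-dilated member of base point `s₀` -/

variable (χu χcu 𝒲 𝒪)

open Classical in
/-- **THE WINDOW-DILATED MEMBER OF BASE POINT `s₀`** (a `W1.TermFun`: the DILATION PARAMETER `b ∈ ℂ` sits in the coupling slot; the older terms and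
the configuration are arguments): print's (2.14) with the interior field dilated by the REAL window point `s₀` ([I] p. 267 «B = g_kB′» at `g_k = s₀`)
and the complex number `b` entering polynomially — precision `b²·A(σ)`, cross kernel `b·Γ(σ)`, last line
`(−1)^{|P|} χᵘ(s₀B) χᶜᵘ(s₀B) exp[Σ_{Y∈𝐃} τ(Y)(b²·s₀⁻²𝒲(φ; Y, s₀B) + 𝒪(old, φ; Y, s₀B))]` — i.e. dag-n10-c's window-dilated family
`term214 r (Z∖Z′₀) 𝐃 (core214 (b²A) (bΓ) (F214 |P| χ χᶜ 𝐃 (b²W + O))) 0 0` AT THE DATUM's kernels `A = 𝔇.A Z t φ`, `Γ = 𝔇.Gam Z t φ`, with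
`χ := χᵘ(s₀·)`, `χᶜ := χᶜᵘ(s₀·)`, `W(Y, B) := s₀⁻²𝒲(φ; Y, s₀B)`, `O(Y, B) := 𝒪(old, φ; Y, s₀B)`.  For the consumer `b = s₀∕u`, `u` a complex last
coupling near `s₀`.  `@[reducible]`; the display is `memberTF_apply`. [cite: Balaban1987RG1, (2.9) p.266, (2.10)-(2.11) p.267 and (2.12)-(2.13) p.268; Balaban1988RG2Cluster, (2.14) p.15] -/
@[reducible] def memberTF (s₀ : ℝ) : TermFun P 𝔸 M k L := fun Z t b old φ =>
  term214 𝔇.r (sigmaList L Z t) (tauList P M k L t)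
    (core214 (fun σ => b ^ 2 • 𝔇.A Z t φ σ) (fun σ X => b • 𝔇.Gam Z t φ σ X)
      (F214 t.2.card (fun B => χu Z t (s₀ • B)) (fun B => χcu Z t (s₀ • B)) t.1
        (fun Y B => b ^ 2 * ((((s₀ : ℝ) : ℂ) ^ 2)⁻¹ * 𝒲 Z t φ Y (s₀ • B)) + 𝒪 Z t old φ Y (s₀ • B)))) 0 0

open Classical in
/-- The display of the window-dilated member (`rfl`). [cite: Balaban1988RG2Cluster, (2.14) p.15; Balaban1987RG1, (2.10)-(2.12) pp.267-268] -/
theorem memberTF_apply (s₀ : ℝ) (Z : (domSys P M (k + 1)).Dom) (t : TermLabel P M k L) (b : ℂ) (old : OlderTerms P 𝔸 M k) (φ : CPair P 𝔸) :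
    𝔇.memberTF χu χcu 𝒲 𝒪 s₀ Z t b old φ =
      term214 𝔇.r (sigmaList L Z t) (tauList P M k L t)
        (core214 (fun σ => b ^ 2 • 𝔇.A Z t φ σ) (fun σ X => b • 𝔇.Gam Z t φ σ X)
          (F214 t.2.card (fun B => χu Z t (s₀ • B)) (fun B => χcu Z t (s₀ • B)) t.1
            (fun Y B => b ^ 2 * ((((s₀ : ℝ) : ℂ) ^ 2)⁻¹ * 𝒲 Z t φ Y (s₀ • B)) + 𝒪 Z t old φ Y (s₀ • B)))) 0 0 :=
  rfl

/-! ## §3  Algebra of the member family: history through `𝒪` only, base-point freeness, the member `b = 1` under the law -/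

open Classical in
/-- **THE HISTORY ENTERS THE MEMBER THROUGH `𝒪` ONLY**: older terms giving the same unscaled older-terms reading at `s₀·B` give the same member.
[cite: Balaban1987RG1, (2.12)-(2.13) p.268; Balaban1988RG2Cluster, (2.14) p.15 and (1.41) p.11] -/
theorem memberTF_congr_old (s₀ : ℝ) (Z : (domSys P M (k + 1)).Dom) (t : TermLabel P M k L) (b : ℂ) {old old' : OlderTerms P 𝔸 M k}
    (φ : CPair P 𝔸) (h : ∀ Y B, 𝒪 Z t old φ Y (s₀ • B) = 𝒪 Z t old' φ Y (s₀ • B)) :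
    𝔇.memberTF χu χcu 𝒲 𝒪 s₀ Z t b old φ = 𝔇.memberTF χu χcu 𝒲 𝒪 s₀ Z t b old' φ := by
  have hV : (fun Y B => b ^ 2 * ((((s₀ : ℝ) : ℂ) ^ 2)⁻¹ * 𝒲 Z t φ Y (s₀ • B)) + 𝒪 Z t old φ Y (s₀ • B))
      = fun Y B => b ^ 2 * ((((s₀ : ℝ) : ℂ) ^ 2)⁻¹ * 𝒲 Z t φ Y (s₀ • B)) + 𝒪 Z t old' φ Y (s₀ • B) :=
    funext fun Y => funext fun B => by rw [h Y B]
  rw [memberTF_apply, memberTF_apply, hV]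

open Classical in
/-- **BASE-POINT FREENESS THROUGH THE REAL RATIO (law-free)**: for base points `s₀, s₁ ≠ 0` the member of base point `s₁` at `(s₁∕s₀)·b` IS the
member of base point `s₀` at `b`, for EVERY complex `b` — dag-n10-c `term214_windowDilated_basePoint` at the real ratio `r = s₁∕s₀` (its four
identities: `χᵘ(s₁B) = χᵘ(s₀(rB))` by `smul_smul`, `(rb)²·s₁⁻²𝒲(s₁B) = b²·s₀⁻²𝒲(s₀(rB))` by `r²s₁⁻² = s₀⁻²`, the older terms likewise).  Two
window points see the same complex coupling `u` through `s₁∕u = r·(s₀∕u)`: the continued family is ONE function of `u`.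
[cite: Balaban1987RG1, (2.9)-(2.12) pp.266-267; Balaban1988RG2Cluster, (2.14) p.15] -/
theorem memberTF_basePoint_of_ne_zero {s₀ s₁ : ℝ} (h0 : s₀ ≠ 0) (h1 : s₁ ≠ 0) (Z : (domSys P M (k + 1)).Dom) (t : TermLabel P M k L)
    (b : ℂ) (old : OlderTerms P 𝔸 M k) (φ : CPair P 𝔸) :
    𝔇.memberTF χu χcu 𝒲 𝒪 s₁ Z t ((((s₁ / s₀ : ℝ)) : ℂ) * b) old φ = 𝔇.memberTF χu χcu 𝒲 𝒪 s₀ Z t b old φ := by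
  have hr : s₁ / s₀ ≠ 0 := div_ne_zero h1 h0
  have hsm : ∀ B : (𝔇.𝒦 Z t).Λ → ℝ, s₀ • ((s₁ / s₀) • B) = s₁ • B := fun B => by
    rw [smul_smul, mul_div_cancel₀ _ h0]
  rw [memberTF_apply, memberTF_apply]
  refine term214_windowDilated_basePoint 𝔇.r (sigmaList L Z t) (tauList P M k L t) (𝔇.A Z t φ) (𝔇.Gam Z t φ) t.2.card t.1 hr b
    (W₁ := fun Y B => (((s₁ : ℝ) : ℂ) ^ 2)⁻¹ * 𝒲 Z t φ Y (s₁ • B)) (W₀ := fun Y B => (((s₀ : ℝ) : ℂ) ^ 2)⁻¹ * 𝒲 Z t φ Y (s₀ • B))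
    (O₁ := fun Y B => 𝒪 Z t old φ Y (s₁ • B)) (O₀ := fun Y B => 𝒪 Z t old φ Y (s₀ • B))
    (fun B => by simp only [hsm]) (fun B => by simp only [hsm]) (fun Y B => ?_) (fun Y B => by simp only [hsm]) 0 0
  -- `(r b)²·s₁⁻²·𝒲(s₁B) = b²·s₀⁻²·𝒲(s₀(rB))`
  simp only [hsm]
  have h0c : ((s₀ : ℝ) : ℂ) ≠ 0 := Complex.ofReal_ne_zero.2 h0
  have h1c : ((s₁ : ℝ) : ℂ) ≠ 0 := Complex.ofReal_ne_zero.2 h1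
  rw [Complex.ofReal_div]
  field_simp

open Classical in
/-- **hMbase — BASE-POINT FREENESS ON THE WINDOW** (law-free): `m(s₁, (s₁∕s₀)·b) = m(s₀, b)` for all `s₀, s₁ ∈ ]0, γ]` and every complex `b` — the
binder shape of the Summit-side window-dilated s1 leaf. [cite: Balaban1987RG1, (2.9)-(2.12) pp.266-267; Balaban1988RG2Cluster, (2.14) p.15] -/
theorem memberTF_basePoint {γ : ℝ} (Z : (domSys P M (k + 1)).Dom) (t : TermLabel P M k L) (old : OlderTerms P 𝔸 M k) (φ : CPair P 𝔸) :
    ∀ s₀ ∈ Ioc (0 : ℝ) γ, ∀ s₁ ∈ Ioc (0 : ℝ) γ, ∀ b : ℂ,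
      𝔇.memberTF χu χcu 𝒲 𝒪 s₁ Z t ((((s₁ / s₀ : ℝ)) : ℂ) * b) old φ = 𝔇.memberTF χu χcu 𝒲 𝒪 s₀ Z t b old φ :=
  fun _ hs₀ _ hs₁ b => 𝔇.memberTF_basePoint_of_ne_zero χu χcu 𝒲 𝒪 hs₀.1.ne' hs₁.1.ne' Z t b old φ

open Classical in
/-- **THE MEMBER `b = 1` AT ONE COUPLING FROM THE LAW AT THAT COUPLING** (pointwise form): if at the real coupling `s` the datum's boxes, large-field
function and potentials are the unscaled-field reading at `s·B` (`𝐕_k = s⁻²𝒲 + 𝒪`), then the member of base point `s` at `b = 1` IS the datum's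
(2.14) display at coupling `s` (`1²•A = A`, `1•Γ = Γ`, the three identities, W1-7 `TF_apply`). [cite: Balaban1987RG1, (2.9)-(2.13) pp.266-268; Balaban1988RG2Cluster, (2.14) p.15] -/
theorem memberTF_one_eq_TF_of_lawAt (Z : (domSys P M (k + 1)).Dom) (t : TermLabel P M k L) (s : ℝ) (old : OlderTerms P 𝔸 M k) (φ : CPair P 𝔸)
    (hχ : ∀ B, 𝔇.chiY₀ Z t (s : ℂ) B = χu Z t (s • B)) (hχc : ∀ B, 𝔇.chicP Z t (s : ℂ) B = χcu Z t (s • B))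
    (hV : ∀ (Y : TDom P.d (L * domCount P M (k + 1))) (B : (𝔇.𝒦 Z t).Λ → ℝ),
      𝔇.𝒱 Z t (s : ℂ) old φ Y B = (((s : ℝ) : ℂ) ^ 2)⁻¹ * 𝒲 Z t φ Y (s • B) + 𝒪 Z t old φ Y (s • B)) :
    𝔇.memberTF χu χcu 𝒲 𝒪 s Z t 1 old φ = 𝔇.TF Z t (s : ℂ) old φ := by
  have hA : (fun σ => (1 : ℂ) ^ 2 • 𝔇.A Z t φ σ) = 𝔇.A Z t φ := funext fun σ => by rw [one_pow, one_smul]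
  have hΓ : (fun σ X => (1 : ℂ) • 𝔇.Gam Z t φ σ X) = 𝔇.Gam Z t φ := funext fun σ => funext fun X => one_smul _ _
  have hF : F214 t.2.card (fun B => χu Z t (s • B)) (fun B => χcu Z t (s • B)) t.1
        (fun Y B => (1 : ℂ) ^ 2 * ((((s : ℝ) : ℂ) ^ 2)⁻¹ * 𝒲 Z t φ Y (s • B)) + 𝒪 Z t old φ Y (s • B))
      = F214 t.2.card (𝔇.chiY₀ Z t (s : ℂ)) (𝔇.chicP Z t (s : ℂ)) t.1 (𝔇.𝒱 Z t (s : ℂ) old φ) := by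
    have e1 : (fun B => χu Z t (s • B)) = 𝔇.chiY₀ Z t (s : ℂ) := funext fun B => (hχ B).symm
    have e2 : (fun B => χcu Z t (s • B)) = 𝔇.chicP Z t (s : ℂ) := funext fun B => (hχc B).symm
    have e3 : (fun Y B => (1 : ℂ) ^ 2 * ((((s : ℝ) : ℂ) ^ 2)⁻¹ * 𝒲 Z t φ Y (s • B)) + 𝒪 Z t old φ Y (s • B)) = 𝔇.𝒱 Z t (s : ℂ) old φ :=
      funext fun Y => funext fun B => by rw [one_pow, one_mul, hV Y B]
    rw [e1, e2, e3]
  rw [memberTF_apply, TermDatum214.TF_apply, hA, hΓ, hF]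

variable {χu χcu 𝒲 𝒪}

open Classical in
/-- **hMagree — UNDER THE UNSCALED-FIELD LAW THE MEMBER `b = 1` OF BASE POINT `s` IS THE DATUM's DISPLAY AT COUPLING `s`**, for every `s ∈ ]0, γ]`:
`m(s, 1) = 𝔇.TF Z t s old φ` — the binder shape of the Summit-side window-dilated s1 leaf. [cite: Balaban1987RG1, §1 p.263 and (2.9)-(2.13) pp.266-268; Balaban1988RG2Cluster, (1.41) p.11 and (2.14) p.15] -/
theorem memberTF_one_eq_TF {γ : ℝ} (hlaw : 𝔇.UnscaledFieldLawOn χu χcu 𝒲 𝒪 γ) (Z : (domSys P M (k + 1)).Dom) (t : TermLabel P M k L)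
    (s : ℝ) (hs : s ∈ Ioc (0 : ℝ) γ) (old : OlderTerms P 𝔸 M k) (φ : CPair P 𝔸) :
    𝔇.memberTF χu χcu 𝒲 𝒪 s Z t 1 old φ = 𝔇.TF Z t (s : ℂ) old φ := by
  obtain ⟨hχ, hχc, hV⟩ := hlaw Z t s hs
  exact 𝔇.memberTF_one_eq_TF_of_lawAt χu χcu 𝒲 𝒪 Z t s old φ hχ hχc (hV old φ)

open Classical in
/-- **THE REAL MEMBER `b = s₀∕s` OF BASE POINT `s₀` IS THE DISPLAY AT COUPLING `s`** (under the law; `s₀, s ∈ ]0, γ]`): [I]'s scaling transformation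
read at two couplings — `B13Term214WindowDilated` §7's real-window agreement (`hagree`) in datum currency, here as base-point freeness at `b = 1`
followed by `memberTF_one_eq_TF`. [cite: Balaban1987RG1, (2.9)-(2.13) pp.266-268; Balaban1988RG2Cluster, (2.14) p.15] -/
theorem memberTF_ofReal_div_eq_TF {γ : ℝ} (hlaw : 𝔇.UnscaledFieldLawOn χu χcu 𝒲 𝒪 γ) (Z : (domSys P M (k + 1)).Dom) (t : TermLabel P M k L)
    {s₀ s : ℝ} (hs₀ : s₀ ∈ Ioc (0 : ℝ) γ) (hs : s ∈ Ioc (0 : ℝ) γ) (old : OlderTerms P 𝔸 M k) (φ : CPair P 𝔸) :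
    𝔇.memberTF χu χcu 𝒲 𝒪 s₀ Z t (((s₀ / s : ℝ)) : ℂ) old φ = 𝔇.TF Z t (s : ℂ) old φ := by
  have h := 𝔇.memberTF_basePoint χu χcu 𝒲 𝒪 (γ := γ) Z t old φ s hs s₀ hs₀ 1
  rw [mul_one] at h
  rw [h]
  exact 𝔇.memberTF_one_eq_TF hlaw Z t s hs old φ

/-! ## §4  The continued term functional read from the base point `γ`: one function of the complex last coupling -/

variable (χu χcu 𝒲 𝒪)

/-- **THE CONTINUED TERM FUNCTIONAL READ FROM THE BASE POINT `γ`** (a `W1.TermFun` of the COMPLEX last coupling `u`): `(Z, t, u, old, φ) ↦ m(γ, γ∕u)` —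
the member of base point `γ` at the dilation parameter `b = γ∕u`.  By `memberTF_basePoint` it is base-point free (`continuedTF_eq_memberTF`: it reads
`m(t₀, t₀∕u)` at ANY `t₀ ≠ 0`, so near a window point `t₀` it is the `t₀`-family on the ball `|b − 1| < ρ_b`), and under the unscaled-field law it
AGREES with the datum's display at every real window coupling (`continuedTF_ofReal_eq_TF`).  At `u = 0` it is the member at `b = 0` (total; never read).
[cite: Balaban1987RG1, §1 p.263 and (2.9)-(2.13) pp.266-268; Balaban1988RG2Cluster, (2.14) p.15] -/
@[reducible] def continuedTF (γ : ℝ) : TermFun P 𝔸 M k L := fun Z t u old φ =>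
  𝔇.memberTF χu χcu 𝒲 𝒪 γ Z t ((γ : ℂ) / u) old φ

/-- The display of the continued term functional (`rfl`). [cite: Balaban1988RG2Cluster, (2.14) p.15 (bookkeeping)] -/
theorem continuedTF_apply (γ : ℝ) (Z : (domSys P M (k + 1)).Dom) (t : TermLabel P M k L) (u : ℂ) (old : OlderTerms P 𝔸 M k) (φ : CPair P 𝔸) :
    𝔇.continuedTF χu χcu 𝒲 𝒪 γ Z t u old φ = 𝔇.memberTF χu χcu 𝒲 𝒪 γ Z t ((γ : ℂ) / u) old φ :=
  rfl

/-- **BASE-POINT FREENESS OF THE CONTINUED FUNCTIONAL** (law-free): for `γ, t₀ ≠ 0` and every complex `u`, the continued functional read from `γ`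
equals the member of base point `t₀` at `b = t₀∕u` (`memberTF_basePoint_of_ne_zero` at the ratio `γ∕t₀`, and `(γ∕t₀)·(t₀∕u) = γ∕u`).
[cite: Balaban1987RG1, (2.9)-(2.12) pp.266-267; Balaban1988RG2Cluster, (2.14) p.15] -/
theorem continuedTF_eq_memberTF {γ t₀ : ℝ} (hγ : γ ≠ 0) (ht₀ : t₀ ≠ 0) (Z : (domSys P M (k + 1)).Dom) (t : TermLabel P M k L) (u : ℂ)
    (old : OlderTerms P 𝔸 M k) (φ : CPair P 𝔸) :
    𝔇.continuedTF χu χcu 𝒲 𝒪 γ Z t u old φ = 𝔇.memberTF χu χcu 𝒲 𝒪 t₀ Z t ((t₀ : ℂ) / u) old φ := by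
  have h := 𝔇.memberTF_basePoint_of_ne_zero χu χcu 𝒲 𝒪 ht₀ hγ Z t ((t₀ : ℂ) / u) old φ
  have hq : (((γ / t₀ : ℝ)) : ℂ) * ((t₀ : ℂ) / u) = (γ : ℂ) / u := by
    have ht₀c : ((t₀ : ℝ) : ℂ) ≠ 0 := Complex.ofReal_ne_zero.2 ht₀
    rw [Complex.ofReal_div, div_mul_div_cancel₀ ht₀c]
  rw [hq] at h
  rw [continuedTF_apply, h]

/-- The window form of `continuedTF_eq_memberTF`: on `]0, γ]` every base point reads the continued functional. [cite: Balaban1987RG1, §1 p.263 and (2.9)-(2.12) pp.266-267] -/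
theorem continuedTF_eq_memberTF_of_mem {γ : ℝ} (Z : (domSys P M (k + 1)).Dom) (t : TermLabel P M k L) (old : OlderTerms P 𝔸 M k) (φ : CPair P 𝔸) :
    ∀ t₀ ∈ Ioc (0 : ℝ) γ, ∀ u : ℂ,
      𝔇.continuedTF χu χcu 𝒲 𝒪 γ Z t u old φ = 𝔇.memberTF χu χcu 𝒲 𝒪 t₀ Z t ((t₀ : ℂ) / u) old φ :=
  fun _ ht₀ u => 𝔇.continuedTF_eq_memberTF χu χcu 𝒲 𝒪 (ht₀.1.trans_le ht₀.2).ne' ht₀.1.ne' Z t u old φ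

variable {χu χcu 𝒲 𝒪}

open Classical in
/-- **THE CONTINUED FUNCTIONAL AGREES WITH THE DATUM's DISPLAY ON THE REAL WINDOW** (under the unscaled-field law): for every `s ∈ ]0, γ]`,
`continuedTF … γ Z t s old φ = 𝔇.TF Z t s old φ` — the `hagree` clause of the Summit-side relative-disc road for `TFc := 𝔇.continuedTF … γ`, a
theorem of the law (`continuedTF_eq_memberTF` at `t₀ = s`, `s∕s = 1`, `memberTF_one_eq_TF`). [cite: Balaban1987RG1, §1 p.263 and (2.9)-(2.13) pp.266-268; Balaban1988RG2Cluster, (2.14) p.15] -/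
theorem continuedTF_ofReal_eq_TF {γ : ℝ} (hlaw : 𝔇.UnscaledFieldLawOn χu χcu 𝒲 𝒪 γ) (Z : (domSys P M (k + 1)).Dom) (t : TermLabel P M k L)
    (s : ℝ) (hs : s ∈ Ioc (0 : ℝ) γ) (old : OlderTerms P 𝔸 M k) (φ : CPair P 𝔸) :
    𝔇.continuedTF χu χcu 𝒲 𝒪 γ Z t (s : ℂ) old φ = 𝔇.TF Z t (s : ℂ) old φ := by
  have hsc : ((s : ℝ) : ℂ) ≠ 0 := Complex.ofReal_ne_zero.2 hs.1.ne'
  rw [𝔇.continuedTF_eq_memberTF_of_mem χu χcu 𝒲 𝒪 Z t old φ s hs, div_self hsc]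
  exact 𝔇.memberTF_one_eq_TF hlaw Z t s hs old φ

end TermDatum214

/-! ## §5  Family level: the law, the member family `mF : ℝ → GenTermFun` and the continued family of a term-datum family -/

namespace TermData214

variable {c : B13.Consts} {P : Params} {𝔸 : Type*} {M L : ℕ} [NeZero L] (𝔇 : TermData214 c P 𝔸 M L)
  (χu χcu : (k : ℕ) → (𝔇 k).UnscaledChi) (𝒲 : (k : ℕ) → (𝔇 k).UnscaledWilson) (𝒪 : (k : ℕ) → (𝔇 k).UnscaledOlder)

/-- **THE UNSCALED-FIELD LAW OF A TERM-DATUM FAMILY** on the window `]0, γ]`: every step's datum obeys it (hypothesis schema).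
[cite: Balaban1987RG1, (2.9)-(2.13) pp.266-268 (every step); Balaban1988RG2Cluster, (2.14) p.15] -/
def UnscaledFieldLawOn (γ : ℝ) : Prop :=
  ∀ k : ℕ, (𝔇 k).UnscaledFieldLawOn (χu k) (χcu k) (𝒲 k) (𝒪 k) γ

/-- The family law unfolded to the per-step conjunctions (`Iff.rfl`; the displayed-hypothesis shape of the Summit-side theorems-only module).
[cite: Balaban1987RG1, (2.9)-(2.13) pp.266-268 (bookkeeping)] -/
theorem unscaledFieldLawOn_iff (γ : ℝ) :
    𝔇.UnscaledFieldLawOn χu χcu 𝒲 𝒪 γ ↔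
      ∀ (k : ℕ) (Z : (domSys P M (k + 1)).Dom) (t : TermLabel P M k L), ∀ s ∈ Ioc (0 : ℝ) γ,
        (∀ B, (𝔇 k).chiY₀ Z t (s : ℂ) B = χu k Z t (s • B)) ∧ (∀ B, (𝔇 k).chicP Z t (s : ℂ) B = χcu k Z t (s • B)) ∧
          ∀ (old : OlderTerms P 𝔸 M k) (φ : CPair P 𝔸) (Y : TDom P.d (L * domCount P M (k + 1))) (B : ((𝔇 k).𝒦 Z t).Λ → ℝ),
            (𝔇 k).𝒱 Z t (s : ℂ) old φ Y B = (((s : ℝ) : ℂ) ^ 2)⁻¹ * 𝒲 k Z t φ Y (s • B) + 𝒪 k Z t old φ Y (s • B) :=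
  Iff.rfl

/-- **THE WINDOW-DILATED MEMBER FAMILY OF A TERM-DATUM FAMILY** — `mF s₀ k := (𝔇 k).memberTF … s₀`: base point `s₀`, then step, `Z`, term label,
dilation parameter in the coupling slot, older terms, configuration (the `mF : ℝ → GenTermFun` of the Summit-side window-dilated s1 leaf).  `@[reducible]`.
[cite: Balaban1987RG1, (2.9)-(2.13) pp.266-268; Balaban1988RG2Cluster, (2.14) p.15] -/
@[reducible] def memberTF : ℝ → GenTermFun P 𝔸 M L := fun s₀ k => (𝔇 k).memberTF (χu k) (χcu k) (𝒲 k) (𝒪 k) s₀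

open Classical in
/-- The display of the member family (`rfl`). [cite: Balaban1988RG2Cluster, (2.14) p.15 (bookkeeping)] -/
theorem memberTF_apply (s₀ : ℝ) (k : ℕ) (Z : (domSys P M (k + 1)).Dom) (t : TermLabel P M k L) (b : ℂ) (old : OlderTerms P 𝔸 M k)
    (φ : CPair P 𝔸) :
    𝔇.memberTF χu χcu 𝒲 𝒪 s₀ k Z t b old φ =
      term214 (𝔇 k).r (sigmaList L Z t) (tauList P M k L t)
        (core214 (fun σ => b ^ 2 • (𝔇 k).A Z t φ σ) (fun σ X => b • (𝔇 k).Gam Z t φ σ X)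
          (F214 t.2.card (fun B => χu k Z t (s₀ • B)) (fun B => χcu k Z t (s₀ • B)) t.1
            (fun Y B => b ^ 2 * ((((s₀ : ℝ) : ℂ) ^ 2)⁻¹ * 𝒲 k Z t φ Y (s₀ • B)) + 𝒪 k Z t old φ Y (s₀ • B)))) 0 0 :=
  rfl

/-- The member family at a step is that step's datum member (`rfl`). [cite: Balaban1988RG2Cluster, (2.14) p.15 (bookkeeping)] -/
theorem memberTF_eq (s₀ : ℝ) (k : ℕ) : 𝔇.memberTF χu χcu 𝒲 𝒪 s₀ k = (𝔇 k).memberTF (χu k) (χcu k) (𝒲 k) (𝒪 k) s₀ := rfl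

/-- **hMbase FOR THE MEMBER FAMILY** (law-free), in the binder shape of the Summit-side window-dilated s1 leaf VERBATIM.
[cite: Balaban1987RG1, (2.9)-(2.12) pp.266-267; Balaban1988RG2Cluster, (2.14) p.15] -/
theorem memberTF_basePoint {γ : ℝ} (k : ℕ) (Z : (domSys P M (k + 1)).Dom) (t : TermLabel P M k L) (old : OlderTerms P 𝔸 M k) (φ : CPair P 𝔸) :
    ∀ s₀ ∈ Ioc (0 : ℝ) γ, ∀ s₁ ∈ Ioc (0 : ℝ) γ, ∀ b : ℂ,
      𝔇.memberTF χu χcu 𝒲 𝒪 s₁ k Z t ((((s₁ / s₀ : ℝ)) : ℂ) * b) old φ = 𝔇.memberTF χu χcu 𝒲 𝒪 s₀ k Z t b old φ :=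
  (𝔇 k).memberTF_basePoint (χu k) (χcu k) (𝒲 k) (𝒪 k) Z t old φ

variable {χu χcu 𝒲 𝒪}

/-- **hMagree FOR THE MEMBER FAMILY UNDER THE FAMILY LAW**, in the binder shape of the Summit-side window-dilated s1 leaf VERBATIM.
[cite: Balaban1987RG1, §1 p.263 and (2.9)-(2.13) pp.266-268; Balaban1988RG2Cluster, (1.41) p.11 and (2.14) p.15] -/
theorem memberTF_one_eq_TF {γ : ℝ} (hlaw : 𝔇.UnscaledFieldLawOn χu χcu 𝒲 𝒪 γ) (k : ℕ) (Z : (domSys P M (k + 1)).Dom) (t : TermLabel P M k L)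
    (s : ℝ) (hs : s ∈ Ioc (0 : ℝ) γ) (old : OlderTerms P 𝔸 M k) (φ : CPair P 𝔸) :
    𝔇.memberTF χu χcu 𝒲 𝒪 s k Z t 1 old φ = (𝔇 k).TF Z t (s : ℂ) old φ :=
  (𝔇 k).memberTF_one_eq_TF (hlaw k) Z t s hs old φ

/-- The real member `b = s₀∕s` of base point `s₀` is step `k`'s display at coupling `s` (under the family law).
[cite: Balaban1987RG1, (2.9)-(2.13) pp.266-268; Balaban1988RG2Cluster, (2.14) p.15] -/
theorem memberTF_ofReal_div_eq_TF {γ : ℝ} (hlaw : 𝔇.UnscaledFieldLawOn χu χcu 𝒲 𝒪 γ) (k : ℕ) (Z : (domSys P M (k + 1)).Dom)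
    (t : TermLabel P M k L) {s₀ s : ℝ} (hs₀ : s₀ ∈ Ioc (0 : ℝ) γ) (hs : s ∈ Ioc (0 : ℝ) γ) (old : OlderTerms P 𝔸 M k) (φ : CPair P 𝔸) :
    𝔇.memberTF χu χcu 𝒲 𝒪 s₀ k Z t (((s₀ / s : ℝ)) : ℂ) old φ = (𝔇 k).TF Z t (s : ℂ) old φ :=
  (𝔇 k).memberTF_ofReal_div_eq_TF (hlaw k) Z t hs₀ hs old φ

variable (χu χcu 𝒲 𝒪)

/-- **THE CONTINUED TERM-FUNCTIONAL FAMILY READ FROM THE BASE POINT `γ`**: `TFc k Z t u old φ := mF γ k Z t (γ∕u) old φ` (a `GenTermFun` of the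
complex last coupling).  `@[reducible]`. [cite: Balaban1987RG1, §1 p.263 and (2.9)-(2.13) pp.266-268; Balaban1988RG2Cluster, (2.14) p.15] -/
@[reducible] def continuedTF (γ : ℝ) : GenTermFun P 𝔸 M L := fun k => (𝔇 k).continuedTF (χu k) (χcu k) (𝒲 k) (𝒪 k) γ

/-- The display of the continued family (`rfl`). [cite: Balaban1988RG2Cluster, (2.14) p.15 (bookkeeping)] -/
theorem continuedTF_apply (γ : ℝ) (k : ℕ) (Z : (domSys P M (k + 1)).Dom) (t : TermLabel P M k L) (u : ℂ) (old : OlderTerms P 𝔸 M k)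
    (φ : CPair P 𝔸) :
    𝔇.continuedTF χu χcu 𝒲 𝒪 γ k Z t u old φ = 𝔇.memberTF χu χcu 𝒲 𝒪 γ k Z t ((γ : ℂ) / u) old φ :=
  rfl

/-- Base-point freeness of the continued family on the window (law-free). [cite: Balaban1987RG1, (2.9)-(2.12) pp.266-267; Balaban1988RG2Cluster, (2.14) p.15] -/
theorem continuedTF_eq_memberTF_of_mem {γ : ℝ} (k : ℕ) (Z : (domSys P M (k + 1)).Dom) (t : TermLabel P M k L) (old : OlderTerms P 𝔸 M k)
    (φ : CPair P 𝔸) :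
    ∀ t₀ ∈ Ioc (0 : ℝ) γ, ∀ u : ℂ,
      𝔇.continuedTF χu χcu 𝒲 𝒪 γ k Z t u old φ = 𝔇.memberTF χu χcu 𝒲 𝒪 t₀ k Z t ((t₀ : ℂ) / u) old φ :=
  (𝔇 k).continuedTF_eq_memberTF_of_mem (χu k) (χcu k) (𝒲 k) (𝒪 k) Z t old φ

variable {χu χcu 𝒲 𝒪}

/-- **hagree FOR THE CONTINUED FAMILY UNDER THE FAMILY LAW**: on the real window the continued family IS the data's display, at every step.
[cite: Balaban1987RG1, §1 p.263 and (2.9)-(2.13) pp.266-268; Balaban1988RG2Cluster, (2.14) p.15] -/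
theorem continuedTF_ofReal_eq_TF {γ : ℝ} (hlaw : 𝔇.UnscaledFieldLawOn χu χcu 𝒲 𝒪 γ) (k : ℕ) (Z : (domSys P M (k + 1)).Dom)
    (t : TermLabel P M k L) (s : ℝ) (hs : s ∈ Ioc (0 : ℝ) γ) (old : OlderTerms P 𝔸 M k) (φ : CPair P 𝔸) :
    𝔇.continuedTF χu χcu 𝒲 𝒪 γ k Z t (s : ℂ) old φ = (𝔇 k).TF Z t (s : ℂ) old φ :=
  (𝔇 k).continuedTF_ofReal_eq_TF (hlaw k) Z t s hs old φ

end TermData214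

/-! ## §6  Honesty: the law is a READING of the datum from unscaled-field data, and it is inhabited -/

namespace TermDatum214

variable {c : B13.Consts} {P : Params} {𝔸 : Type*} {M k L : ℕ} [NeZero L] (𝔇 : TermDatum214 c P 𝔸 M k L)
  (χu χcu : 𝔇.UnscaledChi) (𝒲 : 𝔇.UnscaledWilson) (𝒪 : 𝔇.UnscaledOlder)

/-- **THE DATUM READ IN THE UNSCALED FIELD**: same site torus, kernels `𝒦`, configuration reading `uOf` and Cauchy radius `r` as `𝔇`; the last-line
fields ARE the unscaled-field reading — `χ_{k,Y₀}(s, B) := χᵘ((Re s)·B)`, `χᶜ_{k,P}(s, B) := χᶜᵘ((Re s)·B)`,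
`𝐕_k(Y; s, old, φ; B) := s⁻²·𝒲(φ; Y, (Re s)·B) + 𝒪(old, φ; Y, (Re s)·B)` ([I] (2.9)–(2.13) at real `s`; off the real axis the junk extension by `Re s`,
never read by the law).  This is how an inhabitant of the law arises (NODE 00's datum of record would be read this way from def-B13's kernels); it is
NOT that datum. [cite: Balaban1987RG1, (2.9) p.266, (2.10)-(2.11) p.267 and (2.12)-(2.13) p.268; Balaban1988RG2Cluster, (2.14) p.15] -/
def ofUnscaled : TermDatum214 c P 𝔸 M k L :=
  { 𝔇 with
    chiY₀ := fun Z t s B => χu Z t (s.re • B)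
    chicP := fun Z t s B => χcu Z t (s.re • B)
    𝒱 := fun Z t s old φ Y B => (s ^ 2)⁻¹ * 𝒲 Z t φ Y (s.re • B) + 𝒪 Z t old φ Y (s.re • B) }

/-- Face: the kernels are `𝔇`'s (`rfl`). [cite: Balaban1988RG2Cluster, (2.14) p.15 (bookkeeping)] -/
theorem ofUnscaled_𝒦 : (𝔇.ofUnscaled χu χcu 𝒲 𝒪).𝒦 = 𝔇.𝒦 := rfl

/-- Face: the configuration reading is `𝔇`'s (`rfl`). [cite: Balaban1988RG2Cluster, (2.14) p.15 (bookkeeping)] -/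
theorem ofUnscaled_uOf : (𝔇.ofUnscaled χu χcu 𝒲 𝒪).uOf = 𝔇.uOf := rfl

/-- Face: the Cauchy radius is `𝔇`'s (`rfl`). [cite: Balaban1988RG2Cluster, (2.14) p.15 (bookkeeping)] -/
theorem ofUnscaled_r : (𝔇.ofUnscaled χu χcu 𝒲 𝒪).r = 𝔇.r := rfl

/-- Face: the boxes of the unscaled reading (`rfl`). [cite: Balaban1987RG1, (2.9) p.266 and p.267] -/
theorem ofUnscaled_chiY₀ (Z : (domSys P M (k + 1)).Dom) (t : TermLabel P M k L) (s : ℂ) (B : (𝔇.𝒦 Z t).Λ → ℝ) :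
    (𝔇.ofUnscaled χu χcu 𝒲 𝒪).chiY₀ Z t s B = χu Z t (s.re • B) := rfl

/-- Face: the large-field function of the unscaled reading (`rfl`). [cite: Balaban1987RG1, (2.9) p.266 and p.267] -/
theorem ofUnscaled_chicP (Z : (domSys P M (k + 1)).Dom) (t : TermLabel P M k L) (s : ℂ) (B : (𝔇.𝒦 Z t).Λ → ℝ) :
    (𝔇.ofUnscaled χu χcu 𝒲 𝒪).chicP Z t s B = χcu Z t (s.re • B) := rfl

/-- Face: the potentials of the unscaled reading (`rfl`). [cite: Balaban1987RG1, (2.10) p.267 and (2.12)-(2.13) p.268] -/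
theorem ofUnscaled_𝒱 (Z : (domSys P M (k + 1)).Dom) (t : TermLabel P M k L) (s : ℂ) (old : OlderTerms P 𝔸 M k) (φ : CPair P 𝔸)
    (Y : TDom P.d (L * domCount P M (k + 1))) (B : (𝔇.𝒦 Z t).Λ → ℝ) :
    (𝔇.ofUnscaled χu χcu 𝒲 𝒪).𝒱 Z t s old φ Y B = (s ^ 2)⁻¹ * 𝒲 Z t φ Y (s.re • B) + 𝒪 Z t old φ Y (s.re • B) := rfl

/-- Face: the kernels at the configuration are `𝔇`'s (`rfl`). [cite: Balaban1988RG2Cluster, (2.14) p.15 (bookkeeping)] -/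
theorem ofUnscaled_A : (𝔇.ofUnscaled χu χcu 𝒲 𝒪).A = 𝔇.A := rfl

/-- Face: the cross kernels at the configuration are `𝔇`'s (`rfl`). [cite: Balaban1988RG2Cluster, (2.14) p.15 (bookkeeping)] -/
theorem ofUnscaled_Gam : (𝔇.ofUnscaled χu χcu 𝒲 𝒪).Gam = 𝔇.Gam := rfl

/-- **THE UNSCALED READING OBEYS THE UNSCALED-FIELD LAW on every window** (`Re s = s` at real `s`). [cite: Balaban1987RG1, (2.9)-(2.13) pp.266-268] -/
theorem unscaledFieldLawOn_ofUnscaled (γ : ℝ) : (𝔇.ofUnscaled χu χcu 𝒲 𝒪).UnscaledFieldLawOn χu χcu 𝒲 𝒪 γ := by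
  intro Z t s _
  refine ⟨fun B => ?_, fun B => ?_, fun old φ Y B => ?_⟩
  · show χu Z t ((s : ℂ).re • B) = χu Z t (s • B)
    rw [Complex.ofReal_re]
  · show χcu Z t ((s : ℂ).re • B) = χcu Z t (s • B)
    rw [Complex.ofReal_re]
  · show ((s : ℂ) ^ 2)⁻¹ * 𝒲 Z t φ Y ((s : ℂ).re • B) + 𝒪 Z t old φ Y ((s : ℂ).re • B)
        = (((s : ℝ) : ℂ) ^ 2)⁻¹ * 𝒲 Z t φ Y (s • B) + 𝒪 Z t old φ Y (s • B)
    rw [Complex.ofReal_re]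

/-- **THE MEMBER FAMILY DOES NOT READ THE DATUM's LAST-LINE FIELDS**: the unscaled reading and `𝔇` have the same members (`rfl`).
[cite: Balaban1988RG2Cluster, (2.14) p.15 (bookkeeping)] -/
theorem memberTF_ofUnscaled : (𝔇.ofUnscaled χu χcu 𝒲 𝒪).memberTF χu χcu 𝒲 𝒪 = 𝔇.memberTF χu χcu 𝒲 𝒪 := rfl

open Classical in
/-- Hence for the unscaled reading the member `b = 1` of base point `s > 0` IS its (2.14) display at coupling `s`, with no hypothesis.
[cite: Balaban1987RG1, (2.9)-(2.13) pp.266-268; Balaban1988RG2Cluster, (2.14) p.15] -/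
theorem memberTF_one_eq_TF_ofUnscaled {s : ℝ} (hs : 0 < s) (Z : (domSys P M (k + 1)).Dom) (t : TermLabel P M k L) (old : OlderTerms P 𝔸 M k)
    (φ : CPair P 𝔸) :
    𝔇.memberTF χu χcu 𝒲 𝒪 s Z t 1 old φ = (𝔇.ofUnscaled χu χcu 𝒲 𝒪).TF Z t (s : ℂ) old φ := by
  rw [← memberTF_ofUnscaled]
  exact (𝔇.ofUnscaled χu χcu 𝒲 𝒪).memberTF_one_eq_TF (𝔇.unscaledFieldLawOn_ofUnscaled χu χcu 𝒲 𝒪 s) Z t s ⟨hs, le_rfl⟩ old φ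

end TermDatum214

section Honesty

variable (c : B13.Consts) (P : Params) (𝔸 : Type*) (M k L : ℕ) [NeZero L]

/-- **NON-VACUITY OF THE LAW SCHEMA**: term data obeying the unscaled-field law on a window exist (a degenerate datum of W1-7's `nonempty_termDatum214`
read in the unscaled field with zero data). [cite: Balaban1987RG1, (2.9)-(2.13) pp.266-268 (bookkeeping); Balaban1988RG2Cluster, (2.14) p.15] -/
theorem exists_unscaledFieldLawOn (γ : ℝ) :
    ∃ (𝔇 : TermDatum214 c P 𝔸 M k L) (χu χcu : 𝔇.UnscaledChi) (𝒲 : 𝔇.UnscaledWilson) (𝒪 : 𝔇.UnscaledOlder),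
      𝔇.UnscaledFieldLawOn χu χcu 𝒲 𝒪 γ := by
  obtain ⟨𝔇₀⟩ := nonempty_termDatum214 c P 𝔸 M k L
  exact ⟨𝔇₀.ofUnscaled (fun _ _ _ => 0) (fun _ _ _ => 0) (fun _ _ _ _ _ => 0) (fun _ _ _ _ _ _ => 0), fun _ _ _ => 0, fun _ _ _ => 0,
    fun _ _ _ _ _ => 0, fun _ _ _ _ _ _ => 0, 𝔇₀.unscaledFieldLawOn_ofUnscaled _ _ _ _ γ⟩

/-- Family form: term-datum families obeying the family law exist. [cite: Balaban1987RG1, (2.9)-(2.13) pp.266-268 (bookkeeping)] -/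
theorem exists_unscaledFieldLawOn_family (γ : ℝ) :
    ∃ (𝔇 : TermData214 c P 𝔸 M L) (χu χcu : (k : ℕ) → (𝔇 k).UnscaledChi) (𝒲 : (k : ℕ) → (𝔇 k).UnscaledWilson)
      (𝒪 : (k : ℕ) → (𝔇 k).UnscaledOlder), TermData214.UnscaledFieldLawOn 𝔇 χu χcu 𝒲 𝒪 γ := by
  obtain ⟨𝔇₀⟩ := nonempty_termData214 c P 𝔸 M L
  exact ⟨fun k => (𝔇₀ k).ofUnscaled (fun _ _ _ => 0) (fun _ _ _ => 0) (fun _ _ _ _ _ => 0) (fun _ _ _ _ _ _ => 0),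
    fun _ _ _ _ => 0, fun _ _ _ _ => 0, fun _ _ _ _ _ _ => 0, fun _ _ _ _ _ _ _ => 0,
    fun k => (𝔇₀ k).unscaledFieldLawOn_ofUnscaled _ _ _ _ γ⟩

end Honesty

end W1

end Literature.MathematicalPhysics.QuantumFieldTheory.Balaban1983to89.Node00

end
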